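import Literature.Computability.AlgebraicComplexity.BD17SignatureBoundProofs
import Literature.Computability.AlgebraicComplexity.BD17GaleMinorsProofs
import Mathlib.Analysis.SpecialFunctions.Log.Basic
import HarnessLib

/-!
# Bihan–Dickenstein 2017, §4.2: the Gale correspondence for positive solutions, and Prop. 2.13
# (the finiteness criterion) — PROVED

F. Bihan, A. Dickenstein, *Descartes' rule of signs for polynomial systems supported on circuits*,
Int. Math. Res. Not. IMRN 2017 (22) 6867–6893 = arXiv:1601.05826 [BihanDickenstein2017], §4.2
(held text `paper:arxiv-1601.05826`, p0011:L40–L80 = the proof of Thm. 2.9 up to display (4.5),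
and p0012:L61–L71 "Proof of Proposition (P:noloss)" = Prop. 2.13; printed numbering per
`pub/val-lit/lit/CONCORDANCE-printed.md § BD17`). THEOREMS ONLY; sibling of the statement file
`BD17DescartesCircuits.lean` (cell `val-lit`, row X4-BD17), whose named fact `BD2017_prop_2_13` is
DISCHARGED here BY NAME (`BD2017_prop_2_13_holds`), not restated.

This file formalises the SET-THEORETIC half of the paper's central device (§4.2): the positive
solutions of the circuit system (1.1) correspond bijectively to the rays of the open cone
`Ker(C) ∩ ℝ^{n+2}_{>0}` on which the "norm" `∏_ℓ v_ℓ^{λ_ℓ}` equals `1`, i.e. to the points `y` of the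
Gale interval with `g(y) = ∏_ℓ p_ℓ(y)^{λ_ℓ} = 1` (p0011:L46–L60); multiplicities ([BS08]) are NOT
treated here. In the tree's vocabulary (`BD17.monomial`, `BD17.posSolutions`, `BD17.affRel` = `λ`,
`BD17.expMatrix` = `A`, `BD17.minorClass` = `K_r`, `BD17.lambdaBar` = `λ̄_r`, `BD17.restrictOrdering`
= `ᾱ`), everything in logarithmic form `G = log g = ∑_ℓ λ_ℓ log v_ℓ`:

* the monomial map `x ↦ (x^{w_j})_j`: `BD17.mem_posSolutions_iff`, `BD17.log_monomial_eq_transpose_mulVec`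
  (`log x^{w} = Aᵀ(0, log x)`); `range Aᵀ = λ^⊥` (`BD17.exists_transpose_mulVec_eq_of_dotProduct_eq_zero`,
  by `rk A = n + 1` and a dimension count) and `Aᵀ` injective (`BD17.transpose_mulVec_injective`),
  whence `BD17.eq_of_monomial_eq_smul` (the monomial map is injective modulo nothing: `x^{w} = c x'^{w}`
  forces `c = 1`, `x = x'`) and the converse `BD17.exists_solution_of_sum_log_eq_zero` (a positive
  kernel vector with `∑ λ_ℓ log v_ℓ = 0` is `c · x^{w}` for a positive solution `x`);
* a kernel basis `(u, e)` with `u = x₀^{w} > 0` and `e_0 = 0` (`BD17.exists_ker_partner`,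
  `BD17.isGaleDual_pair`, `BD17.exists_coeffs_pair`, `BD17.eq_zero_of_pair_combo_eq_zero`);
* the classes: `ℓ ∈ K_r ⟺ det(P_{ᾱ_r}, P_ℓ) = 0` (`BD17.mem_minorClass_iff_galeDet_eq_zero`, via the
  minors identity (2.11) of `BD17GaleMinorsProofs`), the classes cover `[n+2]`
  (`BD17.exists_mem_minorClass`, maximality of `K`) and are disjoint (tree), so sums regroup
  (`BD17.sum_eq_sum_minorClass`) and `∑_r λ̄_r = ∑_ℓ λ_ℓ = 0` (`BD17.sum_lambdaBar_eq_zero`);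
* "`g(y) = c · ∏_r p_{ᾱ_r}(y)^{λ̄_r}`" (p0012:L19): `BD17.sum_log_pair_eq`;
* **`BD17.posSolutions_infinite_iff`: given one positive solution, `n_𝒜(C) = ∞ ⟺ all λ̄_r = 0`** —
  (⇐) every point of the Gale interval then yields a solution (`…_infinite_of_lambdaBar_eq_zero`,
  "`g` is identically equal to `1` on `Δ_P`, and `n_𝒜(C)` is infinite", p0012:L70); (⇒) the slopes
  `y(x)` of the solution rays are roots of `∏_{λ̄_r>0}(1 + t_r y)^{λ̄_r} − ∏_{λ̄_r<0}(1 + t_r y)^{−λ̄_r}`,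
  a NONZERO polynomial by unique factorisation (`Polynomial.rootMultiplicity` at `−1/t_{r₀}` for a
  class with `λ̄_{r₀} ≠ 0`, `t_{r₀} ≠ 0`) — the print argues instead through `G' ≢ 0`;
* `BD2017_prop_2_13_holds`: at most one class is orthogonal to the nonzero kernel vector `d`
  (`BD17.eq_of_coord_eq_zero`) and `∑_r λ̄_r = 0`, so "some `λ̄_r ≠ 0`" ⟺ "some `d_{ᾱ_r} λ̄_r ≠ 0`".
  (The ordering hypothesis on `α` is not used; `IsCircuit` only supplies `λ ≠ 0`.)

Honest framing: a typed-literature companion (LADDER-VALIANT V1 ideation source); nothing here bears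
on VP versus VNP. What remains of X4-BD17 by name: Thm. 2.9 (needs the multiplicity half of the
correspondence [BS08] and Descartes' rule Prop. 4.2/4.3 + Rolle), Prop. 2.12, Prop. 4.2 ([P-S]),
Prop. 4.3, Thm. 5.1.

## References

* [BihanDickenstein2017] F. Bihan, A. Dickenstein, IMRN 2017 (22) 6867–6893; arXiv:1601.05826,
  §2.1–§2.3, Prop. 2.13, §4.2.
* [BS08] F. Bihan, F. Sottile, *Gale duality for complete intersections*, Ann. Inst. Fourier 58
  (2008) 877–891 (the multiplicity statement cited in print; not used here).
-/

noncomputable section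

open Matrix Finset

namespace Literature.Computability.AlgebraicComplexity

namespace BD17

variable {n : ℕ}

/-! ### The monomial map `x ↦ (x^{w_0}, …, x^{w_{n+1}})` -/

/-- `x ∈ ℝ^n_{>0}` solves (1.1) iff the monomial vector `(x^{w_j})_j` lies in `Ker(C)` ("`x` is a
solution of (1.1) if and only if there exists `μ` … such that `(x^{w_0}, …, x^{w_{n+1}})ᵗ = B μᵗ`",
p0011:L46). [cite: BihanDickenstein2017, §4.2 (proof of Thm. 2.9)] -/
theorem mem_posSolutions_iff (w : Fin (n + 2) → Fin n → ℤ) (C : Matrix (Fin n) (Fin (n + 2)) ℝ)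
    (x : Fin n → ℝ) :
    x ∈ posSolutions w C ↔ (∀ k, 0 < x k) ∧ C.mulVec (fun j => monomial (w j) x) = 0 := by
  simp only [posSolutions, Set.mem_setOf_eq, systemEval]
  refine and_congr Iff.rfl ⟨fun h => funext fun i => h i, fun h i => congr_fun h i⟩

/-- `x^{v} > 0` for `x ∈ ℝ^n_{>0}`. [cite: BihanDickenstein2017, §1 eq. (1.1)] -/
theorem monomial_pos (v : Fin n → ℤ) {x : Fin n → ℝ} (hx : ∀ k, 0 < x k) : 0 < monomial v x :=
  Finset.prod_pos fun k _ => zpow_pos (hx k) _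

/-- `log x^{v} = ⟨v, log x⟩`. [cite: BihanDickenstein2017, §4.2 (proof of Thm. 2.9)] -/
theorem log_monomial (v : Fin n → ℤ) {x : Fin n → ℝ} (hx : ∀ k, 0 < x k) :
    Real.log (monomial v x) = ∑ k, (v k : ℝ) * Real.log (x k) := by
  rw [monomial, Real.log_prod (fun k _ => (zpow_pos (hx k) _).ne')]
  exact Finset.sum_congr rfl fun k _ => Real.log_zpow _ _

/-- The logarithm of the monomial vector is `Aᵀ (0, log x)` (the rows of `A` are the row of ones and
the coordinates of the `w_j`). [cite: BihanDickenstein2017, §4.2 (proof of Thm. 2.9)] -/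
theorem log_monomial_eq_transpose_mulVec (w : Fin (n + 2) → Fin n → ℤ) {x : Fin n → ℝ}
    (hx : ∀ k, 0 < x k) :
    (fun j => Real.log (monomial (w j) x)) =
      ((expMatrix w).map (Int.cast : ℤ → ℝ))ᵀ.mulVec (Fin.cons 0 fun k => Real.log (x k)) := by
  funext j
  rw [log_monomial _ hx, Matrix.mulVec, dotProduct, Fin.sum_univ_succ]
  simp [expMatrix, Matrix.transpose_apply, Matrix.map_apply]

/-! ### The matrix `A`: `range Aᵀ = λ^⊥`, `Aᵀ` injective -/

/-- `⟨λ, Aᵀ y⟩ = 0`: the range of `Aᵀ` is orthogonal to the affine relation `λ` (since `A λ = 0`).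
[cite: BihanDickenstein2017, §2.1 eq. (2.1)] -/
theorem affRel_dotProduct_transpose_mulVec (w : Fin (n + 2) → Fin n → ℤ) (y : Fin (n + 1) → ℝ) :
    (fun j => (affRel w j : ℝ)) ⬝ᵥ ((expMatrix w).map (Int.cast : ℤ → ℝ))ᵀ.mulVec y = 0 := by
  rw [Matrix.dotProduct_mulVec, Matrix.vecMul_transpose, expMatrix_real_mulVec_affRel,
    zero_dotProduct]

/-- Under (1.3) (`rk A = n + 1`) and for a circuit, `range Aᵀ = λ^⊥`: a vector orthogonal to `λ` is
of the form `Aᵀ y` (dimension count: both sides have dimension `n + 1`).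
[cite: BihanDickenstein2017, §2.1 (before eq. (2.1))] -/
theorem exists_transpose_mulVec_eq_of_dotProduct_eq_zero (w : Fin (n + 2) → Fin n → ℤ)
    (C : Matrix (Fin n) (Fin (n + 2)) ℝ) (hrk : RankCond w C) (hcirc : IsCircuit w)
    {v : Fin (n + 2) → ℝ} (hv : (fun j => (affRel w j : ℝ)) ⬝ᵥ v = 0) :
    ∃ y : Fin (n + 1) → ℝ, ((expMatrix w).map (Int.cast : ℤ → ℝ))ᵀ.mulVec y = v := by
  set A := (expMatrix w).map (Int.cast : ℤ → ℝ) with hA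
  set lam : Fin (n + 2) → ℝ := fun j => (affRel w j : ℝ) with hlam
  -- the functional `v ↦ ⟨λ, v⟩` as a matrix map, and its kernel
  set φ := (Matrix.replicateRow (Fin 1) lam).mulVecLin with hφ
  have hker : ∀ u, u ∈ LinearMap.ker φ ↔ lam ⬝ᵥ u = 0 := by
    intro u
    rw [LinearMap.mem_ker, hφ, Matrix.mulVecLin_apply]
    constructor
    · intro h
      have := congr_fun h 0
      simpa [Matrix.mulVec, Matrix.replicateRow] using this
    · intro h
      funext i
      simp [Matrix.mulVec, Matrix.replicateRow, h]
  -- `range Aᵀ ≤ ker φ`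
  have hle : LinearMap.range Aᵀ.mulVecLin ≤ LinearMap.ker φ := by
    rintro _ ⟨y, rfl⟩
    rw [hker]
    exact affRel_dotProduct_transpose_mulVec w y
  -- dimensions
  have hrange : Module.finrank ℝ (LinearMap.range Aᵀ.mulVecLin) = n + 1 := by
    change Aᵀ.rank = n + 1
    rw [Matrix.rank_transpose]
    exact hrk.1
  have hφsurj : Module.finrank ℝ (LinearMap.range φ) = 1 := by
    apply le_antisymm
    · calc Module.finrank ℝ (LinearMap.range φ) ≤ Module.finrank ℝ (Fin 1 → ℝ) :=
            Submodule.finrank_le _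
        _ = 1 := Module.finrank_fin_fun ℝ
    · rw [Nat.one_le_iff_ne_zero, Ne, Submodule.finrank_eq_zero, LinearMap.range_eq_bot]
      intro h0
      have h1 : φ (Pi.single 0 1) = 0 := by rw [h0]; rfl
      rw [← LinearMap.mem_ker, hker] at h1
      simp [hlam] at h1
      exact hcirc 0 (by exact_mod_cast h1)
  have hkerdim : Module.finrank ℝ (LinearMap.ker φ) = n + 1 := by
    have := LinearMap.finrank_range_add_finrank_ker φ
    rw [hφsurj, Module.finrank_fin_fun] at this
    omega
  have heq : LinearMap.range Aᵀ.mulVecLin = LinearMap.ker φ :=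
    Submodule.eq_of_le_of_finrank_eq hle (by rw [hrange, hkerdim])
  have hvK : v ∈ LinearMap.ker φ := (hker v).mpr hv
  rw [← heq] at hvK
  obtain ⟨y, hy⟩ := hvK
  exact ⟨y, hy⟩

/-- Under (1.3), `Aᵀ` is injective (`rk Aᵀ = rk A = n + 1` = the number of its columns).
[cite: BihanDickenstein2017, §1 eq. (1.3)] -/
theorem transpose_mulVec_injective (w : Fin (n + 2) → Fin n → ℤ) (C : Matrix (Fin n) (Fin (n + 2)) ℝ)
    (hrk : RankCond w C) :
    Function.Injective ((expMatrix w).map (Int.cast : ℤ → ℝ))ᵀ.mulVec := by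
  set A := (expMatrix w).map (Int.cast : ℤ → ℝ) with hA
  have hrange : Module.finrank ℝ (LinearMap.range Aᵀ.mulVecLin) = n + 1 := by
    change Aᵀ.rank = n + 1
    rw [Matrix.rank_transpose]
    exact hrk.1
  have hsum := LinearMap.finrank_range_add_finrank_ker Aᵀ.mulVecLin
  rw [hrange, Module.finrank_fin_fun] at hsum
  have hker : LinearMap.ker Aᵀ.mulVecLin = ⊥ := by
    rw [← Submodule.finrank_eq_zero]
    omega
  rw [← Matrix.coe_mulVecLin]
  exact LinearMap.ker_eq_bot.mp hker

/-- Injectivity of the monomial map up to scaling: if `x^{w_j} = c · x'^{w_j}` for all `j` with `c > 0`,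
then `c = 1` and `x = x'` (under (1.3)). [cite: BihanDickenstein2017, §4.2 (proof of Thm. 2.9)] -/
theorem eq_of_monomial_eq_smul (w : Fin (n + 2) → Fin n → ℤ) (C : Matrix (Fin n) (Fin (n + 2)) ℝ)
    (hrk : RankCond w C) {x x' : Fin n → ℝ} (hx : ∀ k, 0 < x k) (hx' : ∀ k, 0 < x' k)
    {c : ℝ} (hc : 0 < c) (h : ∀ j, monomial (w j) x = c * monomial (w j) x') :
    c = 1 ∧ x = x' := by
  set A := (expMatrix w).map (Int.cast : ℤ → ℝ) with hA
  have hlog : ∀ j, Real.log (monomial (w j) x) = Real.log c + Real.log (monomial (w j) x') := by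
    intro j
    rw [h j, Real.log_mul hc.ne' (monomial_pos _ hx').ne']
  -- `Aᵀ (−log c, log x − log x') = 0`
  have hvec : Aᵀ.mulVec (Fin.cons (-Real.log c) fun k => Real.log (x k) - Real.log (x' k)) = 0 := by
    have e1 := log_monomial_eq_transpose_mulVec w hx
    have e2 := log_monomial_eq_transpose_mulVec w hx'
    have hdiff : (Fin.cons (-Real.log c) fun k => Real.log (x k) - Real.log (x' k) : Fin (n + 1) → ℝ)
        = (Fin.cons 0 fun k => Real.log (x k)) - (Fin.cons 0 fun k => Real.log (x' k)) -
          Fin.cons (Real.log c) (fun _ => 0) := by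
      funext i
      refine Fin.cases ?_ (fun k => ?_) i
      · simp
      · simp
    rw [hdiff, Matrix.mulVec_sub, Matrix.mulVec_sub, ← e1, ← e2]
    funext j
    simp only [Pi.sub_apply, Pi.zero_apply, hlog j]
    have : Aᵀ.mulVec (Fin.cons (Real.log c) (fun _ => 0) : Fin (n + 1) → ℝ) j = Real.log c := by
      rw [Matrix.mulVec, dotProduct, Fin.sum_univ_succ]
      simp [hA, expMatrix, Matrix.transpose_apply, Matrix.map_apply]
    rw [this]
    ring
  have hinj := transpose_mulVec_injective w C hrk
  have h0 : (Fin.cons (-Real.log c) fun k => Real.log (x k) - Real.log (x' k) : Fin (n + 1) → ℝ) = 0 :=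
    hinj (by rw [hvec, Matrix.mulVec_zero])
  have hc1 : Real.log c = 0 := by
    have := congr_fun h0 0
    simp only [Fin.cons_zero, Pi.zero_apply, neg_eq_zero] at this
    exact this
  refine ⟨Real.eq_one_of_pos_of_log_eq_zero hc hc1, funext fun k => ?_⟩
  have hk := congr_fun h0 k.succ
  simp only [Fin.cons_succ, Pi.zero_apply, sub_eq_zero] at hk
  exact Real.log_injOn_pos (Set.mem_Ioi.mpr (hx k)) (Set.mem_Ioi.mpr (hx' k)) hk

/-! ### A basis `(u, e)` of the plane `Ker(C)` with `u > 0` and `e_0 = 0` -/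

/-- The columns `u, e` (independent kernel vectors) of `[u | e]` form a Gale dual of `C`.
[cite: BihanDickenstein2017, §2.2 (before Lemma 2.3)] -/
theorem isGaleDual_pair (C : Matrix (Fin n) (Fin (n + 2)) ℝ) (hrk : C.rank = n)
    {u e : Fin (n + 2) → ℝ} (hu : C.mulVec u = 0) (hu0 : u ≠ 0) (he : C.mulVec e = 0)
    (hespan : e ∉ Submodule.span ℝ {u}) :
    IsGaleDual C (Matrix.of fun j t => (![u, e] : Fin 2 → Fin (n + 2) → ℝ) t j) := by
  have hfun : (fun t : Fin 2 => fun j : Fin (n + 2) =>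
      (Matrix.of fun j t => (![u, e] : Fin 2 → Fin (n + 2) → ℝ) t j) j t) = ![u, e] := by
    funext t j
    simp
  unfold IsGaleDual
  rw [hfun]
  have hind : LinearIndependent ℝ (![u, e] : Fin 2 → Fin (n + 2) → ℝ) := by
    rw [LinearIndependent.pair_iff]
    intro s t hst
    by_cases ht : t = 0
    · subst ht
      simp only [zero_smul, add_zero] at hst
      exact ⟨(smul_eq_zero.mp hst).resolve_right hu0, rfl⟩
    · exfalso
      apply hespan
      rw [Submodule.mem_span_singleton]
      refine ⟨-s / t, ?_⟩
      have : t • e = -(s • u) := eq_neg_of_add_eq_zero_right hst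
      calc (-s / t) • u = t⁻¹ • (-(s • u)) := by rw [div_eq_mul_inv, mul_comm, ← smul_smul, neg_smul]
        _ = e := by rw [← this, smul_smul, inv_mul_cancel₀ ht, one_smul]
  have hle : Submodule.span ℝ (Set.range (![u, e] : Fin 2 → Fin (n + 2) → ℝ)) ≤
      LinearMap.ker C.mulVecLin := by
    rw [Submodule.span_le]
    rintro _ ⟨t, rfl⟩
    fin_cases t
    · simpa using hu
    · simpa using he
  refine Submodule.eq_of_le_of_finrank_le hle ?_
  rw [finrank_ker_mulVecLin_eq_two C hrk, finrank_span_eq_card hind]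
  simp

/-- Coordinates in the basis `(u, e)`: every kernel vector is `a u + b e`.
[cite: BihanDickenstein2017, §2.2 (proof of Lemma 2.3)] -/
theorem exists_coeffs_pair (C : Matrix (Fin n) (Fin (n + 2)) ℝ) (hrk : C.rank = n)
    {u e : Fin (n + 2) → ℝ} (hu : C.mulVec u = 0) (hu0 : u ≠ 0) (he : C.mulVec e = 0)
    (hespan : e ∉ Submodule.span ℝ {u}) {v : Fin (n + 2) → ℝ} (hv : C.mulVec v = 0) :
    ∃ a b : ℝ, ∀ j, v j = a * u j + b * e j := by
  obtain ⟨a, b, hab⟩ := exists_coeffs_of_isGaleDual (isGaleDual_pair C hrk hu hu0 he hespan) hv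
  exact ⟨a, b, fun j => by simpa using hab j⟩

/-- A second kernel vector `e`, independent of the positive kernel vector `u`, normalised so that
`e_0 = 0` (then every positive kernel vector has a positive `u`-coordinate).
[cite: BihanDickenstein2017, §4.2 (the basis `P^i, P^j` with `P^i_{ᾱ_i} = 0`)] -/
theorem exists_ker_partner (C : Matrix (Fin n) (Fin (n + 2)) ℝ) (hrk : C.rank = n)
    {u : Fin (n + 2) → ℝ} (hu : C.mulVec u = 0) (hupos : ∀ j, 0 < u j) :
    ∃ e : Fin (n + 2) → ℝ, C.mulVec e = 0 ∧ e ∉ Submodule.span ℝ {u} ∧ e 0 = 0 := by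
  have hu0 : u ≠ 0 := by
    intro h
    have := hupos 0
    simp [h] at this
  obtain ⟨e₀, he₀, he₀span⟩ := exists_mem_ker_not_mem_span C hrk hu0
  refine ⟨e₀ - (e₀ 0 / u 0) • u, ?_, ?_, ?_⟩
  · rw [Matrix.mulVec_sub, Matrix.mulVec_smul, hu, he₀, smul_zero, sub_zero]
  · intro h
    apply he₀span
    rw [Submodule.mem_span_singleton] at h ⊢
    obtain ⟨c, hc⟩ := h
    refine ⟨c + e₀ 0 / u 0, ?_⟩
    rw [add_smul, hc, sub_add_cancel]
  · have := (hupos 0).ne'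
    simp only [Pi.sub_apply, Pi.smul_apply, smul_eq_mul]
    field_simp
    ring

/-- `u` and `e` are independent: `a u + b e = 0 ⇒ a = b = 0`. [cite: BihanDickenstein2017, §2.2] -/
theorem eq_zero_of_pair_combo_eq_zero {u e : Fin (n + 2) → ℝ} (hu0 : u ≠ 0)
    (hespan : e ∉ Submodule.span ℝ {u}) {a b : ℝ} (h : ∀ j, a * u j + b * e j = 0) :
    a = 0 ∧ b = 0 := by
  by_cases hb : b = 0
  · refine ⟨?_, hb⟩
    by_contra ha
    apply hu0
    funext j
    have := h j
    rw [hb, zero_mul, add_zero] at this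
    exact (mul_eq_zero.mp this).resolve_left ha
  · exfalso
    apply hespan
    rw [Submodule.mem_span_singleton]
    refine ⟨-a / b, funext fun j => ?_⟩
    have := h j
    simp only [Pi.smul_apply, smul_eq_mul]
    field_simp
    linarith

/-! ### The classes `K_r` in Gale-dual terms -/

/-- `det C(a, b) = 0 ⟺ det(P_a, P_b) = 0` for `a ≠ b` (from the minors identity (2.11)).
[cite: BihanDickenstein2017, §2.2 eq. (2.11)] -/
theorem coeffMinor_eq_zero_iff_galeDet_eq_zero (C : Matrix (Fin n) (Fin (n + 2)) ℝ)
    (hrk : C.rank = n) {B : Matrix (Fin (n + 2)) (Fin 2) ℝ} (hB : IsGaleDual C B)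
    {a b : Fin (n + 2)} (hab : a ≠ b) : coeffMinor C a b = 0 ↔ galeDet B a b = 0 := by
  obtain ⟨δ, hδ, hG⟩ := exists_delta_coeffMinor_eq_galeDet C hrk hB
  have h := hG a b hab
  have hne : ((b.val : ℝ) - a.val) ≠ 0 := by
    rw [sub_ne_zero]
    exact_mod_cast (Fin.val_ne_of_ne hab).symm
  have habs : |(b.val : ℝ) - a.val| ≠ 0 := abs_ne_zero.mpr hne
  constructor
  · intro h0
    rw [h0, mul_zero, zero_mul] at h
    rcases mul_eq_zero.mp h.symm with h1 | h1
    · rcases mul_eq_zero.mp h1 with h2 | h2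
      · exact absurd h2 hδ
      · exact absurd h2 habs
    · exact h1
  · intro h0
    rw [h0, mul_zero] at h
    rcases mul_eq_zero.mp h with h1 | h1
    · rcases mul_eq_zero.mp h1 with h2 | h2
      · exact absurd h2 (pow_ne_zero _ (by norm_num))
      · exact h2
    · exact absurd h1 hne

/-- "`ℓ ∈ K_r` if and only if … `P_ℓ = γ_{ℓ r} P_{ᾱ_r}`" (p0011:L79): membership in the class `K_r`
means `det(P_{ᾱ_r}, P_ℓ) = 0`. [cite: BihanDickenstein2017, §4.2 (proof of Thm. 2.9)] -/
theorem mem_minorClass_iff_galeDet_eq_zero (C : Matrix (Fin n) (Fin (n + 2)) ℝ) (hrk : C.rank = n)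
    {B : Matrix (Fin (n + 2)) (Fin 2) ℝ} (hB : IsGaleDual C B) (K : Finset (Fin (n + 2)))
    (α : Equiv.Perm (Fin (n + 2))) (r : Fin K.card) (ℓ : Fin (n + 2)) :
    ℓ ∈ minorClass C K α r ↔ galeDet B (restrictOrdering α K r) ℓ = 0 := by
  simp only [minorClass, Finset.mem_filter, Finset.mem_univ, true_and]
  by_cases h : ℓ = restrictOrdering α K r
  · subst h
    simp only [true_or, true_iff, galeDet]
    ring
  · rw [coeffMinor_eq_zero_iff_galeDet_eq_zero C hrk hB (Ne.symm h)]
    simp [h]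

/-- `ᾱ : [k] → K` is onto `K`. [cite: BihanDickenstein2017, §2.3] -/
theorem exists_restrictOrdering_eq (α : Equiv.Perm (Fin (n + 2))) (K : Finset (Fin (n + 2)))
    {k : Fin (n + 2)} (hk : k ∈ K) : ∃ r : Fin K.card, restrictOrdering α K r = k := by
  classical
  have himg : Finset.univ.image (restrictOrdering α K) = K := by
    apply Finset.eq_of_subset_of_card_le
    · intro x hx
      obtain ⟨r, -, rfl⟩ := Finset.mem_image.mp hx
      exact restrictOrdering_mem α K r
    · rw [Finset.card_image_of_injective _ (restrictOrdering_injective α K), Finset.card_univ,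
        Fintype.card_fin]
  rw [← himg] at hk
  obtain ⟨r, -, hr⟩ := Finset.mem_image.mp hk
  exact ⟨r, hr⟩

/-- The classes `K_r` cover `[n+2]` ("we get a partition `⊔_{j∈[k]} K_j = [n+2]` by the maximality
of `K`", p0007:L23). [cite: BihanDickenstein2017, §2.3 eq. (2.12)] -/
theorem exists_mem_minorClass (C : Matrix (Fin n) (Fin (n + 2)) ℝ) {K : Finset (Fin (n + 2))}
    (hK : IsMaxMinorSet C K) (α : Equiv.Perm (Fin (n + 2))) (ℓ : Fin (n + 2)) :
    ∃ r : Fin K.card, ℓ ∈ minorClass C K α r := by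
  by_cases hℓ : ℓ ∈ K
  · obtain ⟨r, hr⟩ := exists_restrictOrdering_eq α K hℓ
    exact ⟨r, Finset.mem_filter.mpr ⟨Finset.mem_univ _, Or.inl hr.symm⟩⟩
  · have hlt : K ⊂ insert ℓ K := Finset.ssubset_insert hℓ
    have hnot := hK.2 _ hlt
    simp only [MinorsNonzeroOn, not_forall, Finset.mem_insert, exists_prop, not_not] at hnot
    obtain ⟨i, hi, j, hj, hij, h0⟩ := hnot
    -- one of `i, j` is `ℓ`, the other lies in `K`
    rcases hi with rfl | hi
    · rcases hj with rfl | hj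
      · exact absurd rfl hij
      · obtain ⟨r, hr⟩ := exists_restrictOrdering_eq α K hj
        refine ⟨r, Finset.mem_filter.mpr ⟨Finset.mem_univ _, Or.inr ?_⟩⟩
        rw [hr, coeffMinor_eq_zero_comm]
        exact h0
    · rcases hj with rfl | hj
      · obtain ⟨r, hr⟩ := exists_restrictOrdering_eq α K hi
        refine ⟨r, Finset.mem_filter.mpr ⟨Finset.mem_univ _, Or.inr ?_⟩⟩
        rw [hr]
        exact h0
      · exact absurd (hK.1 i hi j hj hij) (not_not.mpr h0)

/-- Summation over the partition `[n+2] = ⊔_r K_r`. [cite: BihanDickenstein2017, §2.3 eq. (2.12)] -/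
theorem sum_eq_sum_minorClass (C : Matrix (Fin n) (Fin (n + 2)) ℝ)
    (hC : ∀ i : Fin (n + 2), Submodule.span ℝ (Cᵀ '' {m | m ≠ i}) = ⊤)
    {K : Finset (Fin (n + 2))} (hK : IsMaxMinorSet C K) (α : Equiv.Perm (Fin (n + 2)))
    {M : Type*} [AddCommMonoid M] (f : Fin (n + 2) → M) :
    ∑ ℓ, f ℓ = ∑ r : Fin K.card, ∑ ℓ ∈ minorClass C K α r, f ℓ := by
  classical
  have hcover : (Finset.univ : Finset (Fin K.card)).biUnion (minorClass C K α) = Finset.univ := by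
    ext ℓ
    simp only [Finset.mem_biUnion, Finset.mem_univ, true_and, iff_true]
    exact exists_mem_minorClass C hK α ℓ
  rw [← Finset.sum_biUnion (fun r _ r' _ h => disjoint_minorClass C hC hK.1 α h), hcover]

/-- `∑_r λ̄_r = ∑_ℓ λ_ℓ = 0`. [cite: BihanDickenstein2017, §2.1 eq. (2.1), §2.3 eq. (2.13)] -/
theorem sum_lambdaBar_eq_zero (w : Fin (n + 2) → Fin n → ℤ) (C : Matrix (Fin n) (Fin (n + 2)) ℝ)
    (hC : ∀ i : Fin (n + 2), Submodule.span ℝ (Cᵀ '' {m | m ≠ i}) = ⊤)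
    {K : Finset (Fin (n + 2))} (hK : IsMaxMinorSet C K) (α : Equiv.Perm (Fin (n + 2))) :
    ∑ r : Fin K.card, lambdaBar w C K α r = 0 := by
  have h := congr_fun (expMatrix_mulVec_affRel w) 0
  simp only [Matrix.mulVec, dotProduct, Pi.zero_apply] at h
  have h1 : ∀ j, expMatrix w 0 j = 1 := fun j => by simp [expMatrix]
  simp only [h1, one_mul] at h
  rw [sum_eq_sum_minorClass C hC hK α (affRel w)] at h
  exact h

/-- `∑_ℓ λ_ℓ = 0` over `ℝ`. [cite: BihanDickenstein2017, §2.1 eq. (2.1)] -/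
theorem sum_affRel_cast_eq_zero (w : Fin (n + 2) → Fin n → ℤ) :
    ∑ ℓ, (affRel w ℓ : ℝ) = 0 := by
  have h := congr_fun (expMatrix_mulVec_affRel w) 0
  simp only [Matrix.mulVec, dotProduct, Pi.zero_apply] at h
  have h1 : ∀ j, expMatrix w 0 j = 1 := fun j => by simp [expMatrix]
  simp only [h1, one_mul] at h
  exact_mod_cast h

/-! ### The logarithmic norm `∑_ℓ λ_ℓ log v_ℓ` (the function `G = log g` of the print) -/

/-- `∑_ℓ λ_ℓ log x^{w_ℓ} = 0`: the monomial vector of a positive point satisfies `g = 1`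
("`x` is a positive solution … if and only if … `g(y) = 1`", p0011:L57–L60).
[cite: BihanDickenstein2017, §4.2 eq. (4.4)] -/
theorem sum_affRel_mul_log_monomial (w : Fin (n + 2) → Fin n → ℤ) {x : Fin n → ℝ}
    (hx : ∀ k, 0 < x k) :
    ∑ ℓ, (affRel w ℓ : ℝ) * Real.log (monomial (w ℓ) x) = 0 := by
  have h := affRel_dotProduct_transpose_mulVec w (Fin.cons 0 fun k => Real.log (x k))
  rw [← log_monomial_eq_transpose_mulVec w hx] at h
  simpa [dotProduct] using h

/-- Scaling invariance: `∑_ℓ λ_ℓ log (c v_ℓ) = ∑_ℓ λ_ℓ log v_ℓ` (since `∑_ℓ λ_ℓ = 0`).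
[cite: BihanDickenstein2017, §4.2 (proof of Thm. 2.9)] -/
theorem sum_affRel_mul_log_smul (w : Fin (n + 2) → Fin n → ℤ) {v : Fin (n + 2) → ℝ}
    (hv : ∀ j, 0 < v j) {c : ℝ} (hc : 0 < c) :
    ∑ ℓ, (affRel w ℓ : ℝ) * Real.log (c * v ℓ) = ∑ ℓ, (affRel w ℓ : ℝ) * Real.log (v ℓ) := by
  have h0 := sum_affRel_cast_eq_zero w
  simp_rw [Real.log_mul hc.ne' (hv _).ne', mul_add, Finset.sum_add_distrib, ← Finset.sum_mul, h0,
    zero_mul, zero_add]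

/-- The converse of the correspondence: a positive kernel vector `v` with `∑_ℓ λ_ℓ log v_ℓ = 0` is,
up to a positive scalar, the monomial vector of a positive solution (`log v ∈ λ^⊥ = range Aᵀ`).
[cite: BihanDickenstein2017, §4.2 (proof of Thm. 2.9)] -/
theorem exists_solution_of_sum_log_eq_zero (w : Fin (n + 2) → Fin n → ℤ)
    (C : Matrix (Fin n) (Fin (n + 2)) ℝ) (hrk : RankCond w C) (hcirc : IsCircuit w)
    {v : Fin (n + 2) → ℝ} (hvpos : ∀ j, 0 < v j) (hvker : C.mulVec v = 0)
    (hN : ∑ ℓ, (affRel w ℓ : ℝ) * Real.log (v ℓ) = 0) :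
    ∃ x ∈ posSolutions w C, ∃ c : ℝ, 0 < c ∧ ∀ j, v j = c * monomial (w j) x := by
  set A := (expMatrix w).map (Int.cast : ℤ → ℝ) with hA
  have hdot : (fun j => (affRel w j : ℝ)) ⬝ᵥ (fun j => Real.log (v j)) = 0 := by
    simpa [dotProduct] using hN
  obtain ⟨y, hy⟩ := exists_transpose_mulVec_eq_of_dotProduct_eq_zero w C hrk hcirc hdot
  set x : Fin n → ℝ := fun k => Real.exp (y k.succ) with hx
  have hxpos : ∀ k, 0 < x k := fun k => Real.exp_pos _
  have hlogx : (fun k => Real.log (x k)) = fun k => y k.succ := by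
    funext k
    rw [hx, Real.log_exp]
  -- `log v_j = y_0 + log x^{w_j}`
  have hlogv : ∀ j, Real.log (v j) = y 0 + Real.log (monomial (w j) x) := by
    intro j
    have e1 := congr_fun (log_monomial_eq_transpose_mulVec w hxpos) j
    have e2 := congr_fun hy j
    rw [hlogx] at e1
    rw [← e2, e1, Matrix.mulVec, Matrix.mulVec, dotProduct, dotProduct, Fin.sum_univ_succ,
      Fin.sum_univ_succ]
    simp [expMatrix, Matrix.transpose_apply, Matrix.map_apply]
  refine ⟨x, ?_, Real.exp (y 0), Real.exp_pos _, fun j => ?_⟩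
  · rw [mem_posSolutions_iff]
    refine ⟨hxpos, ?_⟩
    have hv' : v = Real.exp (y 0) • fun j => monomial (w j) x := by
      funext j
      rw [Pi.smul_apply, smul_eq_mul, ← Real.exp_log (hvpos j), hlogv j, Real.exp_add,
        Real.exp_log (monomial_pos _ hxpos)]
    rw [hv', Matrix.mulVec_smul] at hvker
    exact (smul_eq_zero.mp hvker).resolve_left (Real.exp_pos _).ne'
  · rw [← Real.exp_log (hvpos j), hlogv j, Real.exp_add, Real.exp_log (monomial_pos _ hxpos)]

/-- The factorisation through the classes: for a kernel basis `(u, e)` with `u > 0` and `y` with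
`u + y e > 0`, `∑_ℓ λ_ℓ log(u_ℓ + y e_ℓ) = ∑_ℓ λ_ℓ log u_ℓ + ∑_r λ̄_r log(1 + y e_{ᾱ_r}/u_{ᾱ_r})`
("`g(y) = c · ∏_{r ∈ [k]} p_{ᾱ_r}(y)^{λ̄_r}`", p0012:L19). [cite: BihanDickenstein2017, Prop. 2.12 (proof)] -/
theorem sum_log_pair_eq (w : Fin (n + 2) → Fin n → ℤ) (C : Matrix (Fin n) (Fin (n + 2)) ℝ)
    (hrk : C.rank = n) (hC : ∀ i : Fin (n + 2), Submodule.span ℝ (Cᵀ '' {m | m ≠ i}) = ⊤)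
    {K : Finset (Fin (n + 2))} (hK : IsMaxMinorSet C K) (α : Equiv.Perm (Fin (n + 2)))
    {u e : Fin (n + 2) → ℝ} (hu : C.mulVec u = 0) (hupos : ∀ j, 0 < u j) (he : C.mulVec e = 0)
    (hespan : e ∉ Submodule.span ℝ {u}) {y : ℝ} (hy : ∀ j, 0 < u j + y * e j) :
    ∑ ℓ, (affRel w ℓ : ℝ) * Real.log (u ℓ + y * e ℓ) =
      ∑ ℓ, (affRel w ℓ : ℝ) * Real.log (u ℓ) +
        ∑ r : Fin K.card, (lambdaBar w C K α r : ℝ) *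
          Real.log (1 + y * (e (restrictOrdering α K r) / u (restrictOrdering α K r))) := by
  have hu0 : u ≠ 0 := by
    intro h
    have := hupos 0
    simp [h] at this
  have hB := isGaleDual_pair C hrk hu hu0 he hespan
  -- on the class `K_r`, `e_ℓ / u_ℓ = e_{ᾱ r} / u_{ᾱ r}`
  have hratio : ∀ r, ∀ ℓ ∈ minorClass C K α r,
      u ℓ + y * e ℓ = u ℓ * (1 + y * (e (restrictOrdering α K r) / u (restrictOrdering α K r))) := by
    intro r ℓ hℓ
    rw [mem_minorClass_iff_galeDet_eq_zero C hrk hB K α r ℓ] at hℓ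
    simp only [galeDet, Matrix.of_apply, Matrix.cons_val_zero, Matrix.cons_val_one] at hℓ
    have hur := (hupos (restrictOrdering α K r)).ne'
    field_simp
    linear_combination y * hℓ
  rw [sum_eq_sum_minorClass C hC hK α (fun ℓ => (affRel w ℓ : ℝ) * Real.log (u ℓ + y * e ℓ)),
    sum_eq_sum_minorClass C hC hK α (fun ℓ => (affRel w ℓ : ℝ) * Real.log (u ℓ)),
    ← Finset.sum_add_distrib]
  refine Finset.sum_congr rfl fun r _ => ?_
  have hpos : 0 < 1 + y * (e (restrictOrdering α K r) / u (restrictOrdering α K r)) := by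
    have h1 := hratio r (restrictOrdering α K r)
      (Finset.mem_filter.mpr ⟨Finset.mem_univ _, Or.inl rfl⟩)
    have h2 := hy (restrictOrdering α K r)
    rw [h1] at h2
    exact pos_of_mul_pos_right h2 (hupos _).le
  rw [lambdaBar, Int.cast_sum, Finset.sum_mul, ← Finset.sum_add_distrib]
  refine Finset.sum_congr rfl fun ℓ hℓ => ?_
  rw [hratio r ℓ hℓ, Real.log_mul (hupos ℓ).ne' hpos.ne']
  ring

/-! ### Root multiplicities of products of linear factors `(1 + t X)^m` -/

/-- `rootMultiplicity` is additive over a product of nonzero polynomials. [folklore] -/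
private theorem rootMultiplicity_prod {ι : Type*} (s : Finset ι) (f : ι → Polynomial ℝ)
    (hf : ∀ i ∈ s, f i ≠ 0) (ρ : ℝ) :
    Polynomial.rootMultiplicity ρ (∏ i ∈ s, f i) = ∑ i ∈ s, Polynomial.rootMultiplicity ρ (f i) := by
  classical
  induction s using Finset.induction_on with
  | empty => simp
  | insert a s ha ih =>
    rw [Finset.prod_insert ha, Finset.sum_insert ha,
      Polynomial.rootMultiplicity_mul, ih (fun i hi => hf i (Finset.mem_insert_of_mem hi))]
    exact mul_ne_zero (hf a (Finset.mem_insert_self a s))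
      (Finset.prod_ne_zero_iff.mpr fun i hi => hf i (Finset.mem_insert_of_mem hi))

/-- The linear factor `1 + t X` is nonzero. [folklore] -/
private theorem one_add_C_mul_X_ne_zero (t : ℝ) :
    (1 + Polynomial.C t * Polynomial.X : Polynomial ℝ) ≠ 0 := by
  intro h
  have := congrArg (Polynomial.eval 0) h
  simp at this

/-- `rootMultiplicity ρ ((1 + t X)^m) = m` if `t ≠ 0` and `ρ = −1/t`, and `0` otherwise. [folklore] -/
private theorem rootMultiplicity_one_add_C_mul_X_pow (t ρ : ℝ) (m : ℕ) :
    Polynomial.rootMultiplicity ρ ((1 + Polynomial.C t * Polynomial.X) ^ m) =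
      if t ≠ 0 ∧ ρ = -t⁻¹ then m else 0 := by
  by_cases ht : t = 0
  · simp only [ht, map_zero, zero_mul, add_zero, one_pow, ne_eq, not_true_eq_false, false_and,
      if_false]
    rw [← Polynomial.C_1, Polynomial.rootMultiplicity_C]
  have hfac : (1 + Polynomial.C t * Polynomial.X : Polynomial ℝ) =
      Polynomial.C t * (Polynomial.X - Polynomial.C (-t⁻¹)) := by
    rw [mul_sub, ← Polynomial.C_mul, mul_neg, mul_inv_cancel₀ ht]
    simp
    ring
  rw [hfac, mul_pow, ← Polynomial.C_pow,
    Polynomial.rootMultiplicity_mul (mul_ne_zero (by simp [ht]) (pow_ne_zero _ (Polynomial.X_sub_C_ne_zero _))),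
    Polynomial.rootMultiplicity_C, zero_add]
  by_cases hρ : ρ = -t⁻¹
  · rw [hρ, Polynomial.rootMultiplicity_X_sub_C_pow, if_pos ⟨ht, rfl⟩]
  · rw [if_neg (fun h => hρ h.2), Polynomial.rootMultiplicity_eq_zero]
    rw [Polynomial.IsRoot, Polynomial.eval_pow, Polynomial.eval_sub, Polynomial.eval_X,
      Polynomial.eval_C]
    exact pow_ne_zero _ (sub_ne_zero.mpr hρ)

/-! ### The two directions: `n_𝒜(C) = ∞ ⟺ all λ̄_r = 0` (for a nonempty solution set) -/

/-- If all class sums `λ̄_r` vanish, then (given one positive solution) there are infinitely many: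
"the derivative of `G` over `Δ_P` is identically zero, and thus `g` is constant on `Δ_P` … Thus `g`
is identically equal to `1` on `Δ_P`, and `n_𝒜(C)` is infinite" (p0012:L68–L71).
[cite: BihanDickenstein2017, Prop. 2.13 (proof)] -/
theorem posSolutions_infinite_of_lambdaBar_eq_zero (w : Fin (n + 2) → Fin n → ℤ)
    (C : Matrix (Fin n) (Fin (n + 2)) ℝ) (hrk : RankCond w C) (hcirc : IsCircuit w)
    (hne : (posSolutions w C).Nonempty) {K : Finset (Fin (n + 2))} (hK : IsMaxMinorSet C K)
    (α : Equiv.Perm (Fin (n + 2))) (h0 : ∀ r : Fin K.card, lambdaBar w C K α r = 0) :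
    (posSolutions w C).Infinite := by
  obtain ⟨x₀, hx₀⟩ := hne
  have hx₀' := (mem_posSolutions_iff w C x₀).mp hx₀
  set u : Fin (n + 2) → ℝ := fun j => monomial (w j) x₀ with hu_def
  have hupos : ∀ j, 0 < u j := fun j => monomial_pos _ hx₀'.1
  have hu : C.mulVec u = 0 := hx₀'.2
  have hC := span_cols_erase_eq_top C hrk.2 ⟨u, hupos, hu⟩
  obtain ⟨e, he, hespan, -⟩ := exists_ker_partner C hrk.2 hu hupos
  have hu0 : u ≠ 0 := by
    intro h
    have := hupos 0
    simp [h] at this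
  -- the interval `Δ = {y : u + y e > 0}` is infinite
  set Δ : Set ℝ := {y | ∀ j, 0 < u j + y * e j} with hΔ
  have hΔopen : IsOpen Δ := by
    have : Δ = ⋂ j, {y : ℝ | 0 < u j + y * e j} := by
      ext y
      simp [hΔ]
    rw [this]
    exact isOpen_iInter_of_finite fun j =>
      isOpen_lt continuous_const (continuous_const.add (continuous_id.mul continuous_const))
  have h0Δ : (0 : ℝ) ∈ Δ := fun j => by simpa using hupos j
  have hΔinf : Δ.Infinite := by
    obtain ⟨ε, hε, hball⟩ := Metric.isOpen_iff.mp hΔopen 0 h0Δ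
    refine Set.Infinite.mono hball ?_
    rw [Real.ball_eq_Ioo]
    exact Set.Ioo_infinite (by linarith)
  -- every `y ∈ Δ` gives a positive kernel vector of logarithmic norm `0`, hence a solution
  have hN : ∀ y ∈ Δ, ∑ ℓ, (affRel w ℓ : ℝ) * Real.log (u ℓ + y * e ℓ) = 0 := by
    intro y hy
    rw [sum_log_pair_eq w C hrk.2 hC hK α hu hupos he hespan hy,
      sum_affRel_mul_log_monomial w hx₀'.1]
    simp [h0]
  have hsol : ∀ y ∈ Δ, ∃ x ∈ posSolutions w C, ∃ c : ℝ, 0 < c ∧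
      ∀ j, u j + y * e j = c * monomial (w j) x := by
    intro y hy
    have hker : C.mulVec (fun j => u j + y * e j) = 0 := by
      have : (fun j => u j + y * e j) = u + y • e := by
        funext j
        simp
      rw [this, Matrix.mulVec_add, Matrix.mulVec_smul, hu, he, smul_zero, add_zero]
    exact exists_solution_of_sum_log_eq_zero w C hrk hcirc (v := fun j => u j + y * e j) hy hker
      (hN y hy)
  choose! F hF c hc hFc using hsol
  refine Set.infinite_of_injOn_mapsTo (f := F) ?_ (fun y hy => hF y hy) hΔinf
  intro y hy y' hy' hyy
  have key : ∀ j, (c y' - c y) * u j + (y * c y' - y' * c y) * e j = 0 := by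
    intro j
    have h1 := hFc y hy j
    have h2 := hFc y' hy' j
    rw [hyy] at h1
    linear_combination (c y') * h1 - (c y) * h2
  obtain ⟨ha, hb⟩ := eq_zero_of_pair_combo_eq_zero hu0 hespan key
  have hcc : c y' = c y := by linarith
  rw [hcc] at hb
  have : (y - y') * c y = 0 := by linarith
  rcases mul_eq_zero.mp this with h | h
  · linarith
  · exact absurd h (hc y hy).ne'

/-- If some class sum `λ̄_r` is nonzero, there are finitely many positive solutions: the solutions
inject (via `y = μ_2/μ_1`, the slope of the kernel ray of their monomial vector) into the roots of
the nonzero polynomial `∏_{λ̄_r>0} (1 + t_r y)^{λ̄_r} − ∏_{λ̄_r<0} (1 + t_r y)^{−λ̄_r}` ("`g(y) = 1`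
if and only if `y` is a root of the polynomial `∏_{λ̃_ℓ>0} p_ℓ^{λ̃_ℓ} − ∏_{λ̃_ℓ<0} p_ℓ^{−λ̃_ℓ}`, which
is nonzero because `g ≢ 1`", p0011:L66–L70; nonvanishing by unique factorisation).
[cite: BihanDickenstein2017, Prop. 2.13 (proof)] -/
theorem posSolutions_finite_of_lambdaBar_ne_zero (w : Fin (n + 2) → Fin n → ℤ)
    (C : Matrix (Fin n) (Fin (n + 2)) ℝ) (hrk : RankCond w C)
    {K : Finset (Fin (n + 2))} (hK : IsMaxMinorSet C K) (α : Equiv.Perm (Fin (n + 2)))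
    (hr : ∃ r : Fin K.card, lambdaBar w C K α r ≠ 0) : (posSolutions w C).Finite := by
  classical
  rcases (posSolutions w C).eq_empty_or_nonempty with hemp | ⟨x₀, hx₀⟩
  · rw [hemp]
    exact Set.finite_empty
  have hx₀' := (mem_posSolutions_iff w C x₀).mp hx₀
  set u : Fin (n + 2) → ℝ := fun j => monomial (w j) x₀ with hu_def
  have hupos : ∀ j, 0 < u j := fun j => monomial_pos _ hx₀'.1
  have hu : C.mulVec u = 0 := hx₀'.2
  have hC := span_cols_erase_eq_top C hrk.2 ⟨u, hupos, hu⟩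
  obtain ⟨e, he, hespan, he0⟩ := exists_ker_partner C hrk.2 hu hupos
  have hu0 : u ≠ 0 := by
    intro h
    have := hupos 0
    simp [h] at this
  have hB := isGaleDual_pair C hrk.2 hu hu0 he hespan
  -- coordinates `m(x) = a(x) u + b(x) e` of the solutions, `a(x) > 0`, slope `Y(x) = b/a`
  have hcoef : ∀ x ∈ posSolutions w C, ∃ a b : ℝ, ∀ j, monomial (w j) x = a * u j + b * e j :=
    fun x hx => exists_coeffs_pair C hrk.2 hu hu0 he hespan ((mem_posSolutions_iff w C x).mp hx).2
  choose! a b hab using hcoef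
  have hapos : ∀ x ∈ posSolutions w C, 0 < a x := by
    intro x hx
    have h := hab x hx 0
    rw [he0, mul_zero, add_zero] at h
    have hm := monomial_pos (w 0) ((mem_posSolutions_iff w C x).mp hx).1
    rw [h] at hm
    have : a x = a x * u 0 / u 0 := by field_simp [(hupos 0).ne']
    rw [this]
    exact div_pos hm (hupos 0)
  set Y : (Fin n → ℝ) → ℝ := fun x => b x / a x with hY
  have hmY : ∀ x ∈ posSolutions w C, ∀ j, monomial (w j) x = a x * (u j + Y x * e j) := by
    intro x hx j
    rw [hab x hx j, hY]
    field_simp [(hapos x hx).ne']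
  have hinj : Set.InjOn Y (posSolutions w C) := by
    intro x hx x' hx' hYY
    have h : ∀ j, monomial (w j) x = (a x / a x') * monomial (w j) x' := by
      intro j
      rw [hmY x hx j, hmY x' hx' j, hYY]
      field_simp [(hapos x' hx').ne']
    exact (eq_of_monomial_eq_smul w C hrk ((mem_posSolutions_iff w C x).mp hx).1
      ((mem_posSolutions_iff w C x').mp hx').1 (div_pos (hapos x hx) (hapos x' hx')) h).2
  -- the class slopes `t_r = e_{ᾱ r} / u_{ᾱ r}` and the polynomial
  set t : Fin K.card → ℝ := fun r => e (restrictOrdering α K r) / u (restrictOrdering α K r) with ht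
  set Ppos : Polynomial ℝ := ∏ r ∈ Finset.univ.filter (fun r => 0 < lambdaBar w C K α r),
    (1 + Polynomial.C (t r) * Polynomial.X) ^ (lambdaBar w C K α r).toNat with hPpos
  set Pneg : Polynomial ℝ := ∏ r ∈ Finset.univ.filter (fun r => lambdaBar w C K α r < 0),
    (1 + Polynomial.C (t r) * Polynomial.X) ^ (-lambdaBar w C K α r).toNat with hPneg
  -- every solution slope is a root of `Ppos - Pneg`
  have hroot : ∀ x ∈ posSolutions w C, (Ppos - Pneg).IsRoot (Y x) := by
    intro x hx
    have hxpos := ((mem_posSolutions_iff w C x).mp hx).1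
    have hy : ∀ j, 0 < u j + Y x * e j := by
      intro j
      have h := monomial_pos (w j) hxpos
      rw [hmY x hx j] at h
      have : u j + Y x * e j = a x * (u j + Y x * e j) / a x := by field_simp [(hapos x hx).ne']
      rw [this]
      exact div_pos h (hapos x hx)
    -- logarithmic norm of `u + Y e` vanishes
    have hN : ∑ ℓ, (affRel w ℓ : ℝ) * Real.log (u ℓ + Y x * e ℓ) = 0 := by
      have h1 := sum_affRel_mul_log_smul w hy (hapos x hx)
      have h2 : ∑ ℓ, (affRel w ℓ : ℝ) * Real.log (a x * (u ℓ + Y x * e ℓ)) = 0 := by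
        have := sum_affRel_mul_log_monomial w hxpos
        simpa only [hmY x hx] using this
      rw [h1] at h2
      exact h2
    rw [sum_log_pair_eq w C hrk.2 hC hK α hu hupos he hespan hy,
      sum_affRel_mul_log_monomial w hx₀'.1, zero_add] at hN
    -- split by the sign of `λ̄_r`
    have hspos : ∀ r, 0 < 1 + Y x * t r := by
      intro r
      have h := hy (restrictOrdering α K r)
      have : 1 + Y x * t r = (u (restrictOrdering α K r) + Y x * e (restrictOrdering α K r)) /
          u (restrictOrdering α K r) := by
        rw [ht]
        field_simp [(hupos _).ne']
      rw [this]
      exact div_pos h (hupos _)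
    have hsplit := Finset.sum_filter_add_sum_filter_not Finset.univ
      (fun r => 0 < lambdaBar w C K α r)
      (fun r => (lambdaBar w C K α r : ℝ) * Real.log (1 + Y x * t r))
    have hsplit2 := Finset.sum_filter_add_sum_filter_not
      (Finset.univ.filter fun r => ¬ 0 < lambdaBar w C K α r)
      (fun r => lambdaBar w C K α r < 0)
      (fun r => (lambdaBar w C K α r : ℝ) * Real.log (1 + Y x * t r))
    have hzero : ∑ r ∈ (Finset.univ.filter fun r => ¬ 0 < lambdaBar w C K α r).filter
        (fun r => ¬ lambdaBar w C K α r < 0),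
        (lambdaBar w C K α r : ℝ) * Real.log (1 + Y x * t r) = 0 := by
      refine Finset.sum_eq_zero fun r hr => ?_
      simp only [Finset.mem_filter, Finset.mem_univ, true_and, not_lt] at hr
      have : lambdaBar w C K α r = 0 := le_antisymm hr.1 hr.2
      simp [this]
    have hnegset : (Finset.univ.filter fun r => ¬ 0 < lambdaBar w C K α r).filter
        (fun r => lambdaBar w C K α r < 0) = Finset.univ.filter (fun r => lambdaBar w C K α r < 0) := by
      ext r
      simp only [Finset.mem_filter, Finset.mem_univ, true_and, not_lt, and_iff_right_iff_imp]
      exact fun h => h.le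
    rw [hzero, add_zero, hnegset] at hsplit2
    rw [← hsplit2] at hsplit
    have hN' : ∑ r, (lambdaBar w C K α r : ℝ) * Real.log (1 + Y x * t r) = 0 := by
      simpa only [ht] using hN
    rw [hN'] at hsplit
    -- `log Ppos(Y) = log Pneg(Y)`
    have hlogpos : Real.log (∏ r ∈ Finset.univ.filter (fun r => 0 < lambdaBar w C K α r),
        (1 + Y x * t r) ^ (lambdaBar w C K α r).toNat) =
        ∑ r ∈ Finset.univ.filter (fun r => 0 < lambdaBar w C K α r),
          (lambdaBar w C K α r : ℝ) * Real.log (1 + Y x * t r) := by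
      rw [Real.log_prod (fun r _ => (pow_pos (hspos r) _).ne')]
      refine Finset.sum_congr rfl fun r hr => ?_
      rw [Real.log_pow]
      congr 1
      rw [Finset.mem_filter] at hr
      have : ((lambdaBar w C K α r).toNat : ℤ) = lambdaBar w C K α r := Int.toNat_of_nonneg hr.2.le
      exact_mod_cast this
    have hlogneg : Real.log (∏ r ∈ Finset.univ.filter (fun r => lambdaBar w C K α r < 0),
        (1 + Y x * t r) ^ (-lambdaBar w C K α r).toNat) =
        -∑ r ∈ Finset.univ.filter (fun r => lambdaBar w C K α r < 0),
          (lambdaBar w C K α r : ℝ) * Real.log (1 + Y x * t r) := by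
      rw [Real.log_prod (fun r _ => (pow_pos (hspos r) _).ne'), ← Finset.sum_neg_distrib]
      refine Finset.sum_congr rfl fun r hr => ?_
      rw [Real.log_pow]
      rw [Finset.mem_filter] at hr
      have : ((-lambdaBar w C K α r).toNat : ℤ) = -lambdaBar w C K α r :=
        Int.toNat_of_nonneg (by linarith [hr.2])
      have h' : (((-lambdaBar w C K α r).toNat : ℕ) : ℝ) = -(lambdaBar w C K α r : ℝ) := by
        exact_mod_cast this
      rw [h']
      ring
    have heqlog : Real.log (∏ r ∈ Finset.univ.filter (fun r => 0 < lambdaBar w C K α r),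
        (1 + Y x * t r) ^ (lambdaBar w C K α r).toNat) =
        Real.log (∏ r ∈ Finset.univ.filter (fun r => lambdaBar w C K α r < 0),
        (1 + Y x * t r) ^ (-lambdaBar w C K α r).toNat) := by
      rw [hlogpos, hlogneg]
      linarith
    have hppos : 0 < ∏ r ∈ Finset.univ.filter (fun r => 0 < lambdaBar w C K α r),
        (1 + Y x * t r) ^ (lambdaBar w C K α r).toNat :=
      Finset.prod_pos fun r _ => pow_pos (hspos r) _
    have hpneg : 0 < ∏ r ∈ Finset.univ.filter (fun r => lambdaBar w C K α r < 0),
        (1 + Y x * t r) ^ (-lambdaBar w C K α r).toNat :=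
      Finset.prod_pos fun r _ => pow_pos (hspos r) _
    have heq := Real.log_injOn_pos (Set.mem_Ioi.mpr hppos) (Set.mem_Ioi.mpr hpneg) heqlog
    rw [Polynomial.IsRoot, Polynomial.eval_sub, sub_eq_zero, hPpos, hPneg, Polynomial.eval_prod,
      Polynomial.eval_prod]
    simp only [Polynomial.eval_pow, Polynomial.eval_add, Polynomial.eval_one, Polynomial.eval_mul,
      Polynomial.eval_C, Polynomial.eval_X]
    convert heq using 3 <;> ring
  -- the polynomial is nonzero: pick a class with `λ̄_r ≠ 0` and `t_r ≠ 0`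
  have hsum0 := sum_lambdaBar_eq_zero w C hC hK α
  have ht_inj : ∀ r r', t r = t r' → r = r' := by
    intro r r' hrr
    by_contra hne
    have hmin := hK.1 _ (restrictOrdering_mem α K r) _ (restrictOrdering_mem α K r')
      (fun h => hne (restrictOrdering_injective α K h))
    apply hmin
    rw [coeffMinor_eq_zero_iff_galeDet_eq_zero C hrk.2 hB
      (fun h => hne (restrictOrdering_injective α K h))]
    simp only [galeDet, Matrix.of_apply, Matrix.cons_val_zero, Matrix.cons_val_one]
    rw [ht] at hrr
    have h1 := (hupos (restrictOrdering α K r)).ne'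
    have h2 := (hupos (restrictOrdering α K r')).ne'
    field_simp at hrr
    linear_combination -hrr
  have hex : ∃ r₀, lambdaBar w C K α r₀ ≠ 0 ∧ t r₀ ≠ 0 := by
    obtain ⟨r₁, hr₁⟩ := hr
    by_cases ht₁ : t r₁ ≠ 0
    · exact ⟨r₁, hr₁, ht₁⟩
    rw [not_ne_iff] at ht₁
    have : ∃ r₂, r₂ ≠ r₁ ∧ lambdaBar w C K α r₂ ≠ 0 := by
      by_contra hcon
      push Not at hcon
      have : ∑ r, lambdaBar w C K α r = lambdaBar w C K α r₁ := by
        rw [Finset.sum_eq_single r₁ (fun r _ hr => hcon r hr) (fun h => absurd (Finset.mem_univ _) h)]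
      rw [hsum0] at this
      exact hr₁ this.symm
    obtain ⟨r₂, hr₂, hl₂⟩ := this
    refine ⟨r₂, hl₂, fun ht₂ => hr₂ (ht_inj r₂ r₁ (by rw [ht₂, ht₁]))⟩
  obtain ⟨r₀, hl₀, ht₀⟩ := hex
  have hq : Ppos - Pneg ≠ 0 := by
    intro hq
    rw [sub_eq_zero] at hq
    have hm := congrArg (Polynomial.rootMultiplicity (-(t r₀)⁻¹)) hq
    rw [hPpos, hPneg, rootMultiplicity_prod _ _ (fun r _ => pow_ne_zero _ (one_add_C_mul_X_ne_zero _)),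
      rootMultiplicity_prod _ _ (fun r _ => pow_ne_zero _ (one_add_C_mul_X_ne_zero _))] at hm
    simp only [rootMultiplicity_one_add_C_mul_X_pow] at hm
    have hcollapse : ∀ (s : Finset (Fin K.card)) (m : Fin K.card → ℕ),
        ∑ r ∈ s, (if t r ≠ 0 ∧ -(t r₀)⁻¹ = -(t r)⁻¹ then m r else 0) = if r₀ ∈ s then m r₀ else 0 := by
      intro s m
      rw [← Finset.sum_filter]
      have : s.filter (fun r => t r ≠ 0 ∧ -(t r₀)⁻¹ = -(t r)⁻¹) = s.filter (fun r => r = r₀) := by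
        ext r
        simp only [Finset.mem_filter, and_congr_right_iff]
        intro _
        constructor
        · rintro ⟨htr, h⟩
          exact ht_inj r r₀ (inv_injective (neg_injective h)).symm
        · rintro rfl
          exact ⟨ht₀, rfl⟩
      rw [this, Finset.sum_filter]
      simp [Finset.sum_ite_eq']
    rw [hcollapse, hcollapse] at hm
    simp only [Finset.mem_filter, Finset.mem_univ, true_and] at hm
    rcases lt_or_gt_of_ne hl₀ with hneg | hpos
    · rw [if_neg (not_lt.mpr hneg.le), if_pos hneg] at hm
      have : 0 < (-lambdaBar w C K α r₀).toNat := by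
        rw [Int.lt_toNat]
        simpa using hneg
      omega
    · rw [if_pos hpos, if_neg (not_lt.mpr hpos.le)] at hm
      have : 0 < (lambdaBar w C K α r₀).toNat := by
        rw [Int.lt_toNat]
        simpa using hpos
      omega
  -- conclude
  refine Set.Finite.of_finite_image ((Polynomial.finite_setOf_isRoot hq).subset ?_) hinj
  rintro _ ⟨x, hx, rfl⟩
  exact hroot x hx

/-- **`n_𝒜(C)` is infinite iff all class sums `λ̄_r` vanish** (given a positive solution; the
set-theoretic content of the proofs of Thm. 2.9 / Prop. 2.13). [cite: BihanDickenstein2017, Prop. 2.13 (proof)] -/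
theorem posSolutions_infinite_iff (w : Fin (n + 2) → Fin n → ℤ) (C : Matrix (Fin n) (Fin (n + 2)) ℝ)
    (hrk : RankCond w C) (hcirc : IsCircuit w) (hne : (posSolutions w C).Nonempty)
    {K : Finset (Fin (n + 2))} (hK : IsMaxMinorSet C K) (α : Equiv.Perm (Fin (n + 2))) :
    (posSolutions w C).Infinite ↔ ∀ r : Fin K.card, lambdaBar w C K α r = 0 := by
  constructor
  · intro hinf
    by_contra h
    push Not at h
    exact hinf (posSolutions_finite_of_lambdaBar_ne_zero w C hrk hK α h)
  · exact posSolutions_infinite_of_lambdaBar_eq_zero w C hrk hcirc hne hK α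

/-- At most one class is orthogonal to a nonzero kernel vector `d = a u + b e`: if
`d_{ᾱ_r} = d_{ᾱ_{r'}} = 0` then `r = r'` (the `P_{ᾱ_r}` are pairwise non-proportional).
[cite: BihanDickenstein2017, Prop. 2.13 (proof)] -/
theorem eq_of_coord_eq_zero (C : Matrix (Fin n) (Fin (n + 2)) ℝ) (hrk : C.rank = n)
    {K : Finset (Fin (n + 2))} (hK : MinorsNonzeroOn C K) (α : Equiv.Perm (Fin (n + 2)))
    {u e : Fin (n + 2) → ℝ} (hu : C.mulVec u = 0) (hu0 : u ≠ 0) (he : C.mulVec e = 0)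
    (hespan : e ∉ Submodule.span ℝ {u}) {a b : ℝ} (hab : a ≠ 0 ∨ b ≠ 0) {r r' : Fin K.card}
    (hr : a * u (restrictOrdering α K r) + b * e (restrictOrdering α K r) = 0)
    (hr' : a * u (restrictOrdering α K r') + b * e (restrictOrdering α K r') = 0) : r = r' := by
  by_contra hne
  have hmin := hK _ (restrictOrdering_mem α K r) _ (restrictOrdering_mem α K r')
    (fun h => hne (restrictOrdering_injective α K h))
  apply hmin
  rw [coeffMinor_eq_zero_iff_galeDet_eq_zero C hrk (isGaleDual_pair C hrk hu hu0 he hespan)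
    (fun h => hne (restrictOrdering_injective α K h))]
  simp only [galeDet, Matrix.of_apply, Matrix.cons_val_zero, Matrix.cons_val_one]
  rcases hab with ha | hb
  · have : a * (u (restrictOrdering α K r) * e (restrictOrdering α K r') -
        e (restrictOrdering α K r) * u (restrictOrdering α K r')) = 0 := by
      linear_combination (e (restrictOrdering α K r')) * hr - (e (restrictOrdering α K r)) * hr'
    exact (mul_eq_zero.mp this).resolve_left ha
  · have : b * (u (restrictOrdering α K r) * e (restrictOrdering α K r') -
        e (restrictOrdering α K r) * u (restrictOrdering α K r')) = 0 := by
      linear_combination (u (restrictOrdering α K r)) * hr' - (u (restrictOrdering α K r')) * hr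
    exact (mul_eq_zero.mp this).resolve_left hb

end BD17

open BD17

/-! ### Prop. 2.13 -/

/-- **BD 2017, Prop. 2.13 — DISCHARGED** (`theorem BD2017_prop_2_13_holds : BD2017_prop_2_13`):
"Let `A, C` of maximal rank. Assume `n_𝒜(C) > 0` and let `d` be a nonzero vector in `ker(C)`. Let `α`
be an ordering of `C`. Then `n_𝒜(C)` is finite if and only if there exists `r ∈ [k]` such that
`d_{ᾱ_r} · λ̄_r ≠ 0`." Proof (p0012:L61–L71, made fully explicit): by the Gale correspondence the
solution set is infinite iff all class sums `λ̄_r` vanish (`BD17.posSolutions_infinite_iff`); and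
since `∑_r λ̄_r = 0` while at most one class is orthogonal to `d` (`BD17.eq_of_coord_eq_zero`), some
`λ̄_r ≠ 0` iff some `d_{ᾱ_r} λ̄_r ≠ 0`. (The ordering hypothesis on `α` is not needed.)
[cite: BihanDickenstein2017, Prop. 2.13] -/
theorem BD2017_prop_2_13_holds : BD2017_prop_2_13 := by
  intro n w C hrk hcirc hne d hd0 hd α _hα K hK
  rw [← Set.not_infinite, posSolutions_infinite_iff w C hrk hcirc hne hK α]
  constructor
  · intro hnot
    -- some `λ̄_{r₁} ≠ 0`; the basis `(u, e)` from a solution; at most one class orthogonal to `d`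
    obtain ⟨r₁, hr₁⟩ : ∃ r, lambdaBar w C K α r ≠ 0 := by
      by_contra h
      push Not at h
      exact hnot h
    obtain ⟨x₀, hx₀⟩ := hne
    have hx₀' := (mem_posSolutions_iff w C x₀).mp hx₀
    set u : Fin (n + 2) → ℝ := fun j => monomial (w j) x₀ with hu_def
    have hupos : ∀ j, 0 < u j := fun j => monomial_pos _ hx₀'.1
    have hu : C.mulVec u = 0 := hx₀'.2
    have hC := span_cols_erase_eq_top C hrk.2 ⟨u, hupos, hu⟩
    obtain ⟨e, he, hespan, -⟩ := exists_ker_partner C hrk.2 hu hupos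
    have hu0 : u ≠ 0 := by
      intro h
      have := hupos 0
      simp [h] at this
    obtain ⟨a, b, hab⟩ := exists_coeffs_pair C hrk.2 hu hu0 he hespan hd
    have hab0 : a ≠ 0 ∨ b ≠ 0 := by
      by_contra h
      push Not at h
      apply hd0
      funext j
      rw [hab j, h.1, h.2]
      simp
    have hsum0 := sum_lambdaBar_eq_zero w C hC hK α
    by_cases hd₁ : d (restrictOrdering α K r₁) ≠ 0
    · exact ⟨r₁, mul_ne_zero hd₁ (by exact_mod_cast hr₁)⟩
    rw [not_ne_iff] at hd₁
    -- a second class with `λ̄ ≠ 0`, not orthogonal to `d`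
    have : ∃ r₂, r₂ ≠ r₁ ∧ lambdaBar w C K α r₂ ≠ 0 := by
      by_contra hcon
      push Not at hcon
      have : ∑ r, lambdaBar w C K α r = lambdaBar w C K α r₁ := by
        rw [Finset.sum_eq_single r₁ (fun r _ hr => hcon r hr) (fun h => absurd (Finset.mem_univ _) h)]
      rw [hsum0] at this
      exact hr₁ this.symm
    obtain ⟨r₂, hr₂, hl₂⟩ := this
    refine ⟨r₂, mul_ne_zero (fun hd₂ => hr₂ ?_) (by exact_mod_cast hl₂)⟩
    exact eq_of_coord_eq_zero C hrk.2 hK.1 α hu hu0 he hespan hab0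
      (by rw [← hab]; exact hd₂) (by rw [← hab]; exact hd₁)
  · rintro ⟨r, hr⟩ hall
    exact hr (by rw [hall r]; simp)


end Literature.Computability.AlgebraicComplexity
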